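import Literature.NumberTheory.GaloisCohomology.Howard2004.DVRSettingEngineAssemblyFull
import Literature.NumberTheory.GaloisCohomology.Howard2004.DVRSettingEngineRhoProofs
import Literature.NumberTheory.GaloisCohomology.Howard2004.DVRSettingEngineLamProofs
import Literature.NumberTheory.GaloisCohomology.Howard2004.EngineDecompositionsOfSkewPairingFactProofs
import HarnessLib

/-!
# Howard 2004, Thm. 1.6.1 (`thm161_dvrKolyvaginBound`) from the engine: the eigen-counts `ρ(n)^±` FIXED, `hsmall`
# and `hlam` discharged — two inputs (`h159`, `hcheb`) remain (theorems only)

B. Howard, *The Heegner point Kolyvagin system*, Compositio Math. **140** (2004) (arXiv:1202.6340), Thm. 1.6.1,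
Lemma 1.5.3, Def. 1.5.4, Lemma 1.6.4 (arXiv p. 10 L40–60, p. 11 L23 – p. 12 L33).  `DVRSettingEngineAssemblyFull.
thm161_of_engineInputs_full` (x10b-p1-w2 g16) reduces the typed fact to FIVE engine inputs on full tame-pinned settings,
with ABSTRACT eigen-counts `ρp ρm`.  Howard's `ρ(n)^± = dim H¹_{F(n)}(K, T̄)^±` are, in the cell's currency (x10b-p1-w6 g9
RES-EIGEN, x10b-p1-w8 g11 RHO-ID `DVRSettingEngineRhoProofs`), the `R_k`-lengths of the `τ`-eigen-submodules
`𝓗̄(n)^± = H¹_{F̄(n)}(K, T̄) ∩ ker(τ_* ∓ 1)`; for ℕ-valued letters `ρp ρm` with `(ρ± k n : ℕ∞) = len 𝓗̄(n)^±`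
(`exists_eigenLengths`) the input `hsmall` («`ρ(n)^+ + ρ(n)^- ≤ 1 ⇒ Stub^{(k)}(n) = H¹_{F(n)}`») is w8 g11's
`hsmall_of_eigenLengths`; the input `hlam` («`Stub^{(k)}(n) ≠ 0 ⇒ Stub = H¹_{F(n)}` or `λ < k` with `Stub^{(λ)}(n) = 0`»,
read at the level `λ - 1` of a full tower) is x10b-p2 LEAD g14's `DVRSettingEngineLamProofs.engine_hlam` (Lemma 1.3.3 at
the level `n` + the length count of Def. 1.5.4).  THIS FILE fixes the letters and removes `hsmall` and `hlam`:

* **`DVRSetting.thm161_of_h159_hcheb`** — `thm161_dvrKolyvaginBound` from: on every full tame-pinned setting with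
  H.0–H.5, `𝓛_s ⊂ 𝓛`, `κ_1 ≠ 0`, the two decomposition families, `h159` (Prop. 1.5.9 in the engine shape), and — for
  EVERY pair of ℕ-letters `ρp ρm` reading the eigen-lengths — `hchebI ∧ hchebII` (Lemma 1.6.2 + Lemma 1.5.3 in the
  engine shapes).
* **`DVRSetting.thm161_of_prop141_h159_hcheb`** — the same with the decomposition families SUPPLIED by the print leaf
  C45.1′ `prop141_casselsTate_skewPairing_atLevel` (x9-p1 LEAD g9's `hasLevelDecompositions[At]_of_prop141`): the
  hypothesis list is then `h141` + (`h159`, `hcheb`) per setting.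

THEOREMS ONLY; no definition, no named fact, no instance, no `sorry`.  `thm161_dvrKolyvaginBound` is NOT proved here
(`h159`, `hchebI/II` and the typed levelwise structure remain hypotheses); BSD is not proved by any of this.
-/

set_option autoImplicit false

noncomputable section

open Function NumberField IsDedekindDomain Field
open scoped NumberField ContRepresentation Classical

namespace Literature.NumberTheory.GaloisCohomology.Howard2004

open Literature.NumberTheory.GaloisRepresentations
open Literature.NumberTheory.GaloisRepresentations.DiscreteGaloisModule
open Literature.NumberTheory.GaloisRepresentations.galoisCohomology
open Literature.NumberTheory.EllipticCurves

namespace DVRSetting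

/-- **Howard's Thm. 1.6.1 as typed (`thm161_dvrKolyvaginBound`) from TWO remaining inputs**: from ONE hypothesis —
on every FULL, TAME-PINNED `DVRSetting` with H.0–H.5, `𝓛_s ⊂ 𝓛` for `s ≫ 0` and `κ_1 ≠ 0`: the levelwise structure
(`HasLevelDecompositions`, `HasLevelDecompositionsAt`), the input `h159` (Prop. 1.5.9 in the engine shape), and, for
every pair of ℕ-valued letters `ρp ρm` with `(ρ± k n : ℕ∞) = len_{R_k} 𝓗̄(n)^±` on `𝓝(𝓛^{(2k-1)})`, the Čebotarev inputs
`hchebI ∧ hchebII` (Lemma 1.6.2 with the parity Lemma 1.5.3).  Proof: `thm161_of_engineInputs_full` with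
`ρp ρm := exists_eigenLengths`, `hsmall := hsmall_of_eigenLengths` (RHO-ID, x10b-p1-w8 g11) and `hlam := engine_hlam`
(x10b-p2 LEAD g14).  `thm161_dvrKolyvaginBound` is NOT proved here.
[cite: Howard2004HeegnerKolyvagin, Thm. 1.6.1, Lemma 1.3.3, Lemma 1.5.3, Def. 1.5.4, Lemma 1.6.2, Lemma 1.6.4 (arXiv p. 8 L1–30; p. 10 L40–60; p. 11 L23–58; p. 11 L82 – p. 12 L55)] -/
theorem thm161_of_h159_hcheb
    (h : ∀ (p : ℕ) [Fact p.Prime] (K : Type) [Field K] [NumberField K]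
      (R : Type) [CommRing R] [IsDomain R] [IsDiscreteValuationRing R] [Algebra ℤ_[p] R]
      (N : ℕ → Type) [∀ k, AddCommGroup (N k)] [∀ k, TopologicalSpace (N k)]
      [∀ k, DiscreteTopology (N k)] [∀ k, Module R (N k)]
      (Rk : ℕ → Type) [∀ k, CommRing (Rk k)] [∀ k, IsLocalRing (Rk k)] [∀ k, TopologicalSpace (Rk k)]
      [∀ k, DiscreteTopology (Rk k)] [∀ k, Algebra ℤ_[p] (Rk k)] [∀ k, Algebra R (Rk k)]
      [∀ k, Module (Rk k) (N k)] [∀ k, IsScalarTower R (Rk k) (N k)]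
      (Nbar : Type) [AddCommGroup Nbar] [TopologicalSpace Nbar] [DiscreteTopology Nbar]
      [∀ k, Module (Rk k) Nbar]
      (Nq : ℕ → Finset (HeightOneSpectrum (𝓞 K)) → Type) [∀ k n, AddCommGroup (Nq k n)]
      [∀ k n, TopologicalSpace (Nq k n)] [∀ k n, DiscreteTopology (Nq k n)]
      [∀ k n, Module (Rk k) (Nq k n)] [∀ k n, Module R (Nq k n)]
      [∀ k n, IsScalarTower R (Rk k) (Nq k n)] [∀ k n, Finite (Nq k n)]
      (S : DVRSetting p K R N Rk Nbar Nq) (κ : S.KolyvaginSystem) (hy : S.SatisfiesH)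
      (pins : ∀ v : HeightOneSpectrum (𝓞 K), TamePin v)
      (hP : ∀ k n v, n ∈ levels S.L ∧ v ∈ n → TameHyp (S.LD k).ρq n v),
      (∀ i, S.e i = i + 1) →
      (∀ k, (S.LD k).fs = tameSlotOn pins (S.LD k).ρq (fun n v => n ∈ levels S.L ∧ v ∈ n) (hP k)) →
      S.LargePrimes → κ.one ≠ 0 →
      letI : ∀ k, Module R (galoisCohomology (S.T.ρ k) 1) :=
        fun k => galoisCohomology.moduleH1 (S.T.ρ k) (S.T.hlin k)
      letI : ∀ (k : ℕ) (v : Place K), Module R (galoisCohomology ((S.T.ρ k).toLocal v) 1) :=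
        fun k v => galoisCohomology.moduleH1 ((S.T.ρ k).toLocal v) ((S.T.hlin k).restrictField (Place.Completion v))
      ∃ (hdec : S.HasLevelDecompositions hy) (_ : S.HasLevelDecompositionsAt hy),
        (∀ k n (ℓ : HeightOneSpectrum (𝓞 K)), ↑n ⊆ S.enginePrimes k → ℓ ∈ S.enginePrimes k → ℓ ∉ n →
          S.stub hy hdec k n ≤ LinearMap.ker ((S.locR k (Sum.inr ℓ)).domRestrict (S.selmerModuleAt hy k n)) →
            S.stub hy hdec k (insert ℓ n) ≤
              LinearMap.ker ((S.locR k (Sum.inr ℓ)).domRestrict (S.selmerModuleAt hy k (insert ℓ n)))) ∧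
        (∀ ρp ρm : ℕ → Finset (HeightOneSpectrum (𝓞 K)) → ℕ,
          (∀ (k : ℕ) (n : Finset (HeightOneSpectrum (𝓞 K))), ↑n ⊆ S.enginePrimes k →
            letI := galoisCohomology.moduleH1 S.ρbar (S.isScalarLinear_rhobar hy k)
            (ρp k n : ℕ∞) = Module.length (Rk k) ↥(galoisCohomology.submoduleOfStable (S.isScalarLinear_rhobar hy k)
              ((((hy.h1 k).1.propagateStructure (S.t k).cond).modify (transverseStructure p S.ρbar S.jbar)
                  ∅ ∅ n).selmerGroup ⊓
                (semilinearH S.cd.isLift (S.A k).θ.toAddMonoidHom (S.A k).isSemilinear 1 - AddMonoidHom.id _).ker)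
              (S.scalarMapH1_mem_residualSelmer_inf_ker_sub hy k ∅ ∅ n))) →
          (∀ (k : ℕ) (n : Finset (HeightOneSpectrum (𝓞 K))), ↑n ⊆ S.enginePrimes k →
            letI := galoisCohomology.moduleH1 S.ρbar (S.isScalarLinear_rhobar hy k)
            (ρm k n : ℕ∞) = Module.length (Rk k) ↥(galoisCohomology.submoduleOfStable (S.isScalarLinear_rhobar hy k)
              ((((hy.h1 k).1.propagateStructure (S.t k).cond).modify (transverseStructure p S.ρbar S.jbar)
                  ∅ ∅ n).selmerGroup ⊓
                (semilinearH S.cd.isLift (S.A k).θ.toAddMonoidHom (S.A k).isSemilinear 1 + AddMonoidHom.id _).ker)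
              (S.scalarMapH1_mem_residualSelmer_inf_ker_add hy k ∅ ∅ n))) →
          (∀ k n, ↑n ⊆ S.enginePrimes k → 0 < ρp k n → 0 < ρm k n → ∀ d : ↥(S.selmerModuleAt hy k n), d ≠ 0 →
            S.π • d = 0 → ∃ ℓ ∈ S.enginePrimes k, ℓ ∉ n ∧
              (S.locR k (Sum.inr ℓ)).domRestrict (S.selmerModuleAt hy k n) d ≠ 0 ∧
                ρp k (insert ℓ n) + 1 = ρp k n ∧ ρm k (insert ℓ n) + 1 = ρm k n) ∧
          (∀ k n, ↑n ⊆ S.enginePrimes k → (ρm k n = 0 ∧ 2 ≤ ρp k n) ∨ (ρp k n = 0 ∧ 2 ≤ ρm k n) →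
            ∀ d : ↥(S.selmerModuleAt hy k n), d ≠ 0 → S.π • d = 0 →
              ∃ ℓ ∈ S.enginePrimes k, ℓ ∉ n ∧ (S.locR k (Sum.inr ℓ)).domRestrict (S.selmerModuleAt hy k n) d ≠ 0 ∧
                0 < ρp k (insert ℓ n) ∧ 0 < ρm k (insert ℓ n) ∧
                  ρp k (insert ℓ n) + ρm k (insert ℓ n) = ρp k n + ρm k n))) :
    thm161_dvrKolyvaginBound := by
  refine thm161_of_engineInputs_full ?_
  intro p _ K _ _ R _ _ _ _ N _ _ _ _ Rk _ _ _ _ _ _ _ _ Nbar _ _ _ _ Nq _ _ _ _ _ _ _ S κ hy pins hP hfull htame hL hone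
  obtain ⟨hdec, hdecAt, h159, hcheb⟩ := h p K R N Rk Nbar Nq S κ hy pins hP hfull htame hL hone
  obtain ⟨ρp, ρm, hρp, hρm⟩ := S.exists_eigenLengths hy hdec
  obtain ⟨hchebI, hchebII⟩ := hcheb ρp ρm hρp hρm
  exact ⟨hdec, hdecAt, ρp, ρm, S.engine_hlam hy hfull hdec, h159, S.hsmall_of_eigenLengths hy hdec ρp ρm hρp hρm,
    hchebI, hchebII⟩

/-- **Howard's Thm. 1.6.1 as typed (`thm161_dvrKolyvaginBound`) from the print leaf Prop. 1.4.1 / Thm. 1.4.2 as applied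
(`prop141_casselsTate_skewPairing_atLevel`, C45.1′) and the TWO remaining engine inputs**: the levelwise structure is
SUPPLIED by the leaf (x9-p1 LEAD g9's `hasLevelDecompositions[At]_of_prop141`), so the hypothesis is — on every full,
tame-pinned setting with H.0–H.5, `𝓛_s ⊂ 𝓛` and `κ_1 ≠ 0` — `h159` (Prop. 1.5.9 in the engine shape, at the leaf's
decompositions) and, for every pair of ℕ-letters reading the eigen-lengths, `hchebI ∧ hchebII`.
`thm161_dvrKolyvaginBound` is NOT proved here (two inputs remain; the leaf C45.1′ is a hypothesis by name).
[cite: Howard2004HeegnerKolyvagin, Thm. 1.6.1, Prop. 1.4.1, Thm. 1.4.2, Lemma 1.6.4 (arXiv p. 8 L83–142; p. 11 L23–58; p. 11 L82 – p. 12 L55)] -/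
theorem thm161_of_prop141_h159_hcheb (h141 : prop141_casselsTate_skewPairing_atLevel)
    (h : ∀ (p : ℕ) [Fact p.Prime] (K : Type) [Field K] [NumberField K]
      (R : Type) [CommRing R] [IsDomain R] [IsDiscreteValuationRing R] [Algebra ℤ_[p] R]
      (N : ℕ → Type) [∀ k, AddCommGroup (N k)] [∀ k, TopologicalSpace (N k)]
      [∀ k, DiscreteTopology (N k)] [∀ k, Module R (N k)]
      (Rk : ℕ → Type) [∀ k, CommRing (Rk k)] [∀ k, IsLocalRing (Rk k)] [∀ k, TopologicalSpace (Rk k)]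
      [∀ k, DiscreteTopology (Rk k)] [∀ k, Algebra ℤ_[p] (Rk k)] [∀ k, Algebra R (Rk k)]
      [∀ k, Module (Rk k) (N k)] [∀ k, IsScalarTower R (Rk k) (N k)]
      (Nbar : Type) [AddCommGroup Nbar] [TopologicalSpace Nbar] [DiscreteTopology Nbar]
      [∀ k, Module (Rk k) Nbar]
      (Nq : ℕ → Finset (HeightOneSpectrum (𝓞 K)) → Type) [∀ k n, AddCommGroup (Nq k n)]
      [∀ k n, TopologicalSpace (Nq k n)] [∀ k n, DiscreteTopology (Nq k n)]
      [∀ k n, Module (Rk k) (Nq k n)] [∀ k n, Module R (Nq k n)]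
      [∀ k n, IsScalarTower R (Rk k) (Nq k n)] [∀ k n, Finite (Nq k n)]
      (S : DVRSetting p K R N Rk Nbar Nq) (κ : S.KolyvaginSystem) (hy : S.SatisfiesH)
      (pins : ∀ v : HeightOneSpectrum (𝓞 K), TamePin v)
      (hP : ∀ k n v, n ∈ levels S.L ∧ v ∈ n → TameHyp (S.LD k).ρq n v),
      (∀ i, S.e i = i + 1) →
      (∀ k, (S.LD k).fs = tameSlotOn pins (S.LD k).ρq (fun n v => n ∈ levels S.L ∧ v ∈ n) (hP k)) →
      S.LargePrimes → κ.one ≠ 0 →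
      letI : ∀ k, Module R (galoisCohomology (S.T.ρ k) 1) :=
        fun k => galoisCohomology.moduleH1 (S.T.ρ k) (S.T.hlin k)
      letI : ∀ (k : ℕ) (v : Place K), Module R (galoisCohomology ((S.T.ρ k).toLocal v) 1) :=
        fun k v => galoisCohomology.moduleH1 ((S.T.ρ k).toLocal v) ((S.T.hlin k).restrictField (Place.Completion v))
      (∀ k n (ℓ : HeightOneSpectrum (𝓞 K)), ↑n ⊆ S.enginePrimes k → ℓ ∈ S.enginePrimes k → ℓ ∉ n →
        S.stub hy (S.hasLevelDecompositions_of_prop141 h141 hy) k n ≤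
            LinearMap.ker ((S.locR k (Sum.inr ℓ)).domRestrict (S.selmerModuleAt hy k n)) →
          S.stub hy (S.hasLevelDecompositions_of_prop141 h141 hy) k (insert ℓ n) ≤
            LinearMap.ker ((S.locR k (Sum.inr ℓ)).domRestrict (S.selmerModuleAt hy k (insert ℓ n)))) ∧
      (∀ ρp ρm : ℕ → Finset (HeightOneSpectrum (𝓞 K)) → ℕ,
        (∀ (k : ℕ) (n : Finset (HeightOneSpectrum (𝓞 K))), ↑n ⊆ S.enginePrimes k →
          letI := galoisCohomology.moduleH1 S.ρbar (S.isScalarLinear_rhobar hy k)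
          (ρp k n : ℕ∞) = Module.length (Rk k) ↥(galoisCohomology.submoduleOfStable (S.isScalarLinear_rhobar hy k)
            ((((hy.h1 k).1.propagateStructure (S.t k).cond).modify (transverseStructure p S.ρbar S.jbar)
                ∅ ∅ n).selmerGroup ⊓
              (semilinearH S.cd.isLift (S.A k).θ.toAddMonoidHom (S.A k).isSemilinear 1 - AddMonoidHom.id _).ker)
            (S.scalarMapH1_mem_residualSelmer_inf_ker_sub hy k ∅ ∅ n))) →
        (∀ (k : ℕ) (n : Finset (HeightOneSpectrum (𝓞 K))), ↑n ⊆ S.enginePrimes k →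
          letI := galoisCohomology.moduleH1 S.ρbar (S.isScalarLinear_rhobar hy k)
          (ρm k n : ℕ∞) = Module.length (Rk k) ↥(galoisCohomology.submoduleOfStable (S.isScalarLinear_rhobar hy k)
            ((((hy.h1 k).1.propagateStructure (S.t k).cond).modify (transverseStructure p S.ρbar S.jbar)
                ∅ ∅ n).selmerGroup ⊓
              (semilinearH S.cd.isLift (S.A k).θ.toAddMonoidHom (S.A k).isSemilinear 1 + AddMonoidHom.id _).ker)
            (S.scalarMapH1_mem_residualSelmer_inf_ker_add hy k ∅ ∅ n))) →
        (∀ k n, ↑n ⊆ S.enginePrimes k → 0 < ρp k n → 0 < ρm k n → ∀ d : ↥(S.selmerModuleAt hy k n), d ≠ 0 →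
          S.π • d = 0 → ∃ ℓ ∈ S.enginePrimes k, ℓ ∉ n ∧
            (S.locR k (Sum.inr ℓ)).domRestrict (S.selmerModuleAt hy k n) d ≠ 0 ∧
              ρp k (insert ℓ n) + 1 = ρp k n ∧ ρm k (insert ℓ n) + 1 = ρm k n) ∧
        (∀ k n, ↑n ⊆ S.enginePrimes k → (ρm k n = 0 ∧ 2 ≤ ρp k n) ∨ (ρp k n = 0 ∧ 2 ≤ ρm k n) →
          ∀ d : ↥(S.selmerModuleAt hy k n), d ≠ 0 → S.π • d = 0 →
            ∃ ℓ ∈ S.enginePrimes k, ℓ ∉ n ∧ (S.locR k (Sum.inr ℓ)).domRestrict (S.selmerModuleAt hy k n) d ≠ 0 ∧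
              0 < ρp k (insert ℓ n) ∧ 0 < ρm k (insert ℓ n) ∧
                ρp k (insert ℓ n) + ρm k (insert ℓ n) = ρp k n + ρm k n))) :
    thm161_dvrKolyvaginBound := by
  refine thm161_of_h159_hcheb ?_
  intro p _ K _ _ R _ _ _ _ N _ _ _ _ Rk _ _ _ _ _ _ _ _ Nbar _ _ _ _ Nq _ _ _ _ _ _ _ S κ hy pins hP hfull htame hL hone
  obtain ⟨h159, hcheb⟩ := h p K R N Rk Nbar Nq S κ hy pins hP hfull htame hL hone
  exact ⟨S.hasLevelDecompositions_of_prop141 h141 hy, S.hasLevelDecompositionsAt_of_prop141 h141 hy, h159, hcheb⟩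

end DVRSetting

end Literature.NumberTheory.GaloisCohomology.Howard2004

end
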